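import Summits.KontsevichZagierPeriods.KontsevichZagierPeriods.Theorems.SoloInformedKZPOneKValues
import HarnessLib
import HarnessLib.Audit

/-!
# SoloInformed — areas under graphs: two-dimensional representations in the span of points and segments

Solo programme `solo-KontsevichZagierPeriods-informed`, session s112, file 21.

The span of points and segments is an additive subgroup of formal representations of ALL
dimensions containing the relations; any representation congruent modulo relations to a member is
a member, and the Kontsevich–Zagier period conjecture holds between any two members
(`soloInformed_equivalent_of_mem_segSpan`).  By the fibrewise Newton–Leibniz move (rule (3),
`KZ.exists_underGraph`, [Viu-Sos 2021, Cor. 2.3]) the AREA representation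
`[ {(x,t) : x ∈ D, 0 ≤ t ≤ f(x)}, 1 ]` of dimension `2` is congruent to `[D, f]` when `f ≥ 0` on `D`
(`soloInformed_area_mem_segSpan`).  Hence (`soloInformed_kzp_area_K`): the period conjecture holds
between the area of the plane region under the graph of a non-negative rational function with real
algebraic coefficients over a `ℚ`-semialgebraic `D ⊆ ℝ` and (i) any other such area, (ii) any
absolutely convergent `∫_{D'} N/M dx` with real algebraic coefficients, (iii) any rational
representation of dimension `≤ 1` — whenever the values agree.

References: M. Kontsevich, D. Zagier, *Periods* (2001), §1.1–1.2; J. Viu-Sos (2021), Cor. 2.3.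
-/

noncomputable section

open scoped BigOperators Polynomial

namespace Summit.KontsevichZagierPeriods.KontsevichZagierPeriods.Theorems

open Set MeasureTheory
open Literature.ModelTheory.ExponentialFields
open Literature.NumberTheory.Transcendental Literature.NumberTheory.Transcendental.KZ

/-- **The area under the graph of a non-negative member is a member.** For `r = [D, f]` of
dimension `n` in the span with `f ≥ 0` on `D`, every representation `G` of dimension `n + 1` with
domain the band `{(x, t) | x ∈ D, 0 ≤ t ≤ f x}` and integrand `1` on it lies in the span.
[Viu-Sos 2021, Cor. 2.3; this work] -/
theorem soloInformed_area_mem_segSpan {n : ℕ} (r : IntegralRep n) (hr : of r ∈ soloInformedSegSpan)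
    (h0 : ∀ x ∈ r.domain, 0 ≤ r.integrand x) (G : IntegralRep (n + 1))
    (hGdom : G.domain = KZlog.band r.domain (fun _ => 0) r.integrand)
    (hG1 : ∀ z ∈ G.domain, G.integrand z = 1) : of G ∈ soloInformedSegSpan := by
  obtain ⟨G', hG'dom, hG'1, hrel⟩ := exists_underGraph r h0
  have h1 : of G - of G' ∈ relations :=
    of_sub_of_mem_relations_of_eqOn (by rw [hG'dom, hGdom]) fun z hz => by
      rw [hG1 z hz, hG'1]
  have h2 : of G' ∈ soloInformedSegSpan :=
    soloInformed_mem_segSpan_of_sub_mem (newtonLeibnizRel_subset_relations hrel) hr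
  exact soloInformed_mem_segSpan_of_sub_mem h1 h2

/-- The area representation over a `K`-rational representation of dimension `1` with non-negative
integrand lies in the span. -/
theorem soloInformed_area_mem_segSpan_K (r : IntegralRep 1) (hr : SoloInformedIsKRationalOne r)
    (h0 : ∀ x ∈ r.domain, 0 ≤ r.integrand x) (G : IntegralRep 2)
    (hGdom : G.domain = KZlog.band r.domain (fun _ => 0) r.integrand)
    (hG1 : ∀ z ∈ G.domain, G.integrand z = 1) : of G ∈ soloInformedSegSpan :=
  soloInformed_area_mem_segSpan r (soloInformed_segSpan_of_isKRationalOne r hr) h0 G hGdom hG1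

/-- **The period conjecture for areas under graphs of non-negative `K`-rational functions of one
variable**: such an area representation (dimension `2`) with the same value as (i) another one,
(ii) a member of the `K`-rational class of dimension `1`, or (iii) a rational representation of
dimension `≤ 1`, is KZ-equivalent to it. [Kontsevich–Zagier 2001, §1.2 Question 1; this work] -/
theorem soloInformed_kzp_area_K (r : IntegralRep 1) (hr : SoloInformedIsKRationalOne r)
    (h0 : ∀ x ∈ r.domain, 0 ≤ r.integrand x) (G : IntegralRep 2)
    (hGdom : G.domain = KZlog.band r.domain (fun _ => 0) r.integrand)
    (hG1 : ∀ z ∈ G.domain, G.integrand z = 1) :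
    (∀ (r₁ : IntegralRep 1) (_ : SoloInformedIsKRationalOne r₁)
        (_ : ∀ x ∈ r₁.domain, 0 ≤ r₁.integrand x) (G₁ : IntegralRep 2),
        G₁.domain = KZlog.band r₁.domain (fun _ => 0) r₁.integrand →
        (∀ z ∈ G₁.domain, G₁.integrand z = 1) → G.value = G₁.value → Equivalent G G₁) ∧
    (∀ r' : IntegralRep 1, SoloInformedIsKRationalOne r' → G.value = r'.value → Equivalent G r') ∧
    (∀ {m : ℕ} (hm : m ≤ 1) (r₀ : IntegralRep m), r₀.IsRational → G.value = r₀.value →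
        Equivalent G r₀) := by
  have hG := soloInformed_area_mem_segSpan_K r hr h0 G hGdom hG1
  refine ⟨fun r₁ hr₁ h0₁ G₁ hd₁ h1₁ hv => soloInformed_equivalent_of_mem_segSpan hG
      (soloInformed_area_mem_segSpan_K r₁ hr₁ h0₁ G₁ hd₁ h1₁) hv,
    fun r' hr' hv => soloInformed_equivalent_of_mem_segSpan hG
      (soloInformed_segSpan_of_isKRationalOne r' hr') hv,
    fun hm r₀ hr₀ hv => soloInformed_equivalent_of_mem_segSpan hG
      (soloInformed_of_mem_segSpan_of_isRational hm r₀ hr₀) hv⟩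

/-- The value of the area representation is the integral: `vol{(x,t) : x ∈ D, 0 ≤ t ≤ f x} = ∫_D f`
(soundness of the moves applied to `[G] − [r] ∈ relations`). -/
theorem soloInformed_value_area {n : ℕ} (r : IntegralRep n)
    (h0 : ∀ x ∈ r.domain, 0 ≤ r.integrand x) (G : IntegralRep (n + 1))
    (hGdom : G.domain = KZlog.band r.domain (fun _ => 0) r.integrand)
    (hG1 : ∀ z ∈ G.domain, G.integrand z = 1) : G.value = r.value := by
  -- soundness of the moves on `[G] − [r]`
  obtain ⟨G', hG'dom, hG'1, hrel⟩ := exists_underGraph r h0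
  have h1 : of G - of G' ∈ relations :=
    of_sub_of_mem_relations_of_eqOn (by rw [hG'dom, hGdom]) fun z hz => by
      rw [hG1 z hz, hG'1]
  have h2 : of G - of r ∈ relations := by
    have : of G - of r = (of G - of G') + (of G' - of r) := by abel
    rw [this]
    exact relations.add_mem h1 (newtonLeibnizRel_subset_relations hrel)
  have h3 : eval (of G - of r) = 0 := relations_le_ker_eval_holds h2
  rw [map_sub, eval_of, eval_of, sub_eq_zero] at h3
  exact h3

end Summit.KontsevichZagierPeriods.KontsevichZagierPeriods.Theorems
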